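import Summits.CriticalPhenomena.PercolationContinuityZ3.Theorems.FK.Transplant.UFSC0SlabBoxSquares
import HarnessLib

/-!
# FRONTIER TRANSPLANT — K1 in finite form (K1-FIN), piece (P2a-ii): nearest-neighbour boundaries inside a box of `ℤ²`
# are `★`-connected (Timár's lemma for the square lattice induced on a box; the rim of a pocket)

Support file (`--supports stmt-CriticalPhenomena-4575`, helper) of the FRONTIER TRANSPLANT sub-cell
(`fk-continuity/transplant/`, seat `prim-bschramm-fkt-p3`); builds on p205010 (kernel theorem, internal audit signed;
external expert review pending). Memo row K1-FIN [g130, R67] (bytes-first package). 0 named facts · 0 sorries ·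
standard axioms; pure combinatorics of `ℤ²` / `ℤ^d` (no measure, no `FH`, no `UFSC0` in this file).
Registered R70 (cell INBOX l.5267, 2026-08-23); registry row T4k; lead label T4k-02 (fkt-lead L44, l.5255).

HONEST FRAMING (page 1, cell rule). The transplant's theorem of record `ufsc0_of_freeBoundaryHypothesis_r3` is
CONDITIONAL on FH AND on TP_FK, both OPEN at the same `p` for `q > 1` (⇔ GRC Conj. (5.103) via K1; barrier note
`Literature.Barriers.CriticalPhenomena.SamePFreeBoundaryCriteria`, FBN-01); the transplant is a typed reduction, not a
proof of FK continuity. K1-FIN (`(∃ r, UFSC0) ⟹ (∃ L, Π(p, L))`) changes nothing in the record (`_r3` « 2 / 0 ☑ »,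
n_open = 2); this file is planar combinatorics only.

## What is here (namespace `Summit.CriticalPhenomena.PercolationContinuityZ3.Theorems.FK.SlabBox`)

The Peierls step of K1-FIN runs Kozma–Nitzan's exploration (macro-lattice `ℤ²`) under the free random-cluster law
of a FINITE slab box, so the macro-cluster lives in a finite macro-box `Λ = [a, b] ⊆ ℤ²` and the blocked set that
cuts a macro-site `y` off the cluster is a boundary RELATIVE TO THE BOX. Timár's lemma for the nearest-neighbour
graph of `ℤ²` INDUCED on `Λ` (the tree has the absolute `ℤ²` case, `Z2SquareCycles` + `CycleSpaceSeparators`, and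
the `★`-graph box case, `StarBoundaryBox`; the nearest-neighbour box case is new here):

* §1 `starConn_pick_box` — **Timár in a box, nearest-neighbour form**: `A ⊆ Λ` nn-connected with `Λ ∖ A`
  nn-connected ⇒ the picked endpoints of the lattice edges of `Λ` crossing `A` form a `★`-connected set
  (`exists_generator_crossing_both_rel` with `V = Λ`, generators `boxSquares` of file (P2a-i));
* §2 `reflTransGen_adjIn_sdiff_of_component` (the complement in `Λ` of an nn-component of `Λ ∖ K`, `K`
  nn-connected, is nn-connected) and **`starConn_rim`**: for `O ⊆ Λ` nn-connected and `Q` an nn-component of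
  `Λ ∖ O`, the rim `{z ∈ Q : z ∼ O}` is `★`-connected (Deuschel–Pisztora's Lemma 2.1 (ii) situation, nn form);
* §3 `supDist_triangle`, `supDist_le_length`, `supDist_le_card_sub_one_of_starConn` — a `★`-connected finite set lies
  within sup-distance `#Z - 1` of each of its points.

## References

* Á. Timár, *Boundary-connectivity via graph theory*, Proc. AMS 141 (2013) 475–480, Lemma 1, Theorem 3 [Timar2013].
* J.-D. Deuschel, Á. Pisztora, Probab. Theory Related Fields 104 (1996) 467–482, Lemma 2.1 (ii) [DeuschelPisztora1996].
* S. Friedli, Y. Velenik, *Statistical Mechanics of Lattice Systems*, CUP 2017, App. B.15, Lemmas B.82–B.83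
  [FriedliVelenik2017].
* G. Grimmett, *The Random-Cluster Model*, Springer 2006, §5.7 Conj. (5.103) [Grimmett2006].
-/

noncomputable section

open Finset SimpleGraph Relation
open Literature.Combinatorics.SimpleGraph.CycleSpace

namespace Summit.CriticalPhenomena.PercolationContinuityZ3.Theorems.FK

namespace SlabBox

open Literature.Probability.Percolation Literature.Probability.LatticeModels

/-! ### §1 Timár's lemma for the square lattice induced on a box -/

/-- **Timár in a box, nearest-neighbour form (two-in-one).** Let `A ⊆ Λ = [a, b] ⊆ ℤ²` be such that any two points
of `A` are joined by a lattice path inside `A` and any two points of `Λ ∖ A` by a lattice path inside `Λ ∖ A`, and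
choose an endpoint `pick u v ∈ {u, v}` of every pair. Then the picked endpoints of the lattice edges `uv` with
`u ∈ A`, `v ∈ Λ ∖ A` form a `★`-connected set. Proof: across a splitting of these crossing edges with no `★`-edge
between the picked classes, Lemma B.83 relative to `V = Λ` (`exists_generator_crossing_both_rel`) with the box
squares as generators (`inSpan_boxSquares`) yields one unit square inside `Λ` carrying crossing edges of both
classes, whose picked endpoints are distinct corners of that square, hence `★`-adjacent.
[cite: Timar2013, Lemma 1 and Theorem 3; FriedliVelenik2017, App. B.15, Lemmas B.82–B.83] -/
theorem starConn_pick_box {a b : Site 2} {A : Finset (Site 2)} (hAV : A ⊆ Finset.Icc a b)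
    (hA : ∀ x ∈ A, ∀ x' ∈ A, ∃ p : (zdGraph 2).Walk x x', ∀ w ∈ p.support, w ∈ A)
    (hAc : ∀ y ∈ (↑(Finset.Icc a b) : Set (Site 2)), y ∉ A → ∀ y' ∈ (↑(Finset.Icc a b) : Set (Site 2)), y' ∉ A →
      ∃ p : (zdGraph 2).Walk y y', ∀ w ∈ p.support, w ∈ (↑(Finset.Icc a b) : Set (Site 2)) ∧ w ∉ A)
    (pick : Site 2 → Site 2 → Site 2) (hpick : ∀ u v, pick u v = u ∨ pick u v = v) :
    StarConn {z | ∃ u v, u ∈ A ∧ v ∈ Finset.Icc a b ∧ v ∉ A ∧ (zdGraph 2).Adj u v ∧ pick u v = z} := by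
  classical
  set Λ : Finset (Site 2) := Finset.Icc a b with hΛ
  set P : Set (Site 2) := {z | ∃ u v, u ∈ A ∧ v ∈ Λ ∧ v ∉ A ∧ (zdGraph 2).Adj u v ∧ pick u v = z} with hP
  intro x hx y hy
  by_contra hxy
  obtain ⟨ax, bx, hax, hbxΛ, hbx, hadjx, hpx⟩ := hx
  obtain ⟨ay, cy, hay, hcyΛ, hcy, hadjy, hpy⟩ := hy
  -- the crossing lattice edges inside the box
  set E : Finset (Sym2 (Site 2)) :=
    A.biUnion fun u => ((Λ.filter fun v => v ∉ A ∧ (zdGraph 2).Adj u v).image fun v => s(u, v)) with hE'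
  have hE : ∀ e, e ∈ E ↔ ∃ u v, u ∈ A ∧ v ∈ Λ ∧ v ∉ A ∧ (zdGraph 2).Adj u v ∧ e = s(u, v) := by
    intro e
    simp only [hE', mem_biUnion, mem_image, mem_filter]
    constructor
    · rintro ⟨u, hu, v, ⟨hvΛ, hvA, hadj⟩, rfl⟩
      exact ⟨u, v, hu, hvΛ, hvA, hadj, rfl⟩
    · rintro ⟨u, v, hu, hvΛ, hvA, hadj, rfl⟩
      exact ⟨u, hu, v, ⟨hvΛ, hvA, hadj⟩, rfl⟩
  -- a crossing edge has a unique orientation from `A` to `Λ ∖ A`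
  have horient : ∀ u v u' v', u ∈ A → v ∉ A → u' ∈ A → v' ∉ A → s(u, v) = s(u', v') → u = u' ∧ v = v' := by
    intro u v u' v' hu hv hu' hv' h
    rcases Sym2.eq_iff.1 h with ⟨h1, h2⟩ | ⟨h1, h2⟩
    · exact ⟨h1, h2⟩
    · exact absurd (h1 ▸ hu) hv'
  -- the class of `x` and the induced splitting of the crossing edges
  set P₁ : Set (Site 2) := {z | ReflTransGen (starRel P) x z} with hP₁
  set E₁ : Finset (Sym2 (Site 2)) :=
    E.filter fun e => ∃ u v, u ∈ A ∧ v ∉ A ∧ e = s(u, v) ∧ pick u v ∈ P₁ with hE₁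
  set E₂ : Finset (Sym2 (Site 2)) :=
    E.filter fun e => ∃ u v, u ∈ A ∧ v ∉ A ∧ e = s(u, v) ∧ pick u v ∉ P₁ with hE₂
  have hEpart : ∀ e, e ∈ E₁ ∨ e ∈ E₂ ↔
      e ∈ (zdGraph 2).edgeSet ∧ (∀ v ∈ e, v ∈ (↑Λ : Set (Site 2))) ∧ Crosses A e := by
    intro e
    constructor
    · rintro (h | h)
      · obtain ⟨u, v, hu, hvΛ, hv, hadj, rfl⟩ := (hE e).1 (mem_filter.1 h).1
        refine ⟨(mem_edgeSet _).2 hadj, fun w hw => ?_, (crosses_mk A u v).2 (Or.inl ⟨hu, hv⟩)⟩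
        rcases Sym2.mem_iff.1 hw with rfl | rfl
        · exact mem_coe.2 (hAV hu)
        · exact mem_coe.2 hvΛ
      · obtain ⟨u, v, hu, hvΛ, hv, hadj, rfl⟩ := (hE e).1 (mem_filter.1 h).1
        refine ⟨(mem_edgeSet _).2 hadj, fun w hw => ?_, (crosses_mk A u v).2 (Or.inl ⟨hu, hv⟩)⟩
        rcases Sym2.mem_iff.1 hw with rfl | rfl
        · exact mem_coe.2 (hAV hu)
        · exact mem_coe.2 hvΛ
    · rintro ⟨hedge, hΛe, hcr⟩
      obtain ⟨u, v, hu, hvΛ, hv, hadj, rfl⟩ :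
          ∃ u v, u ∈ A ∧ v ∈ Λ ∧ v ∉ A ∧ (zdGraph 2).Adj u v ∧ e = s(u, v) := by
        revert hedge hcr hΛe
        induction e using Sym2.ind with
        | h u v =>
          intro hedge hΛe hcr
          rw [crosses_mk] at hcr
          rw [mem_edgeSet] at hedge
          rcases hcr with ⟨hu, hv⟩ | ⟨hu, hv⟩
          · exact ⟨u, v, hu, mem_coe.1 (hΛe v (Sym2.mem_mk_right u v)), hv, hedge, rfl⟩
          · exact ⟨v, u, hv, mem_coe.1 (hΛe u (Sym2.mem_mk_left u v)), hu, hedge.symm, Sym2.eq_swap⟩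
      have heE : s(u, v) ∈ E := (hE _).2 ⟨u, v, hu, hvΛ, hv, hadj, rfl⟩
      by_cases hp : pick u v ∈ P₁
      · exact Or.inl (mem_filter.2 ⟨heE, u, v, hu, hv, rfl, hp⟩)
      · exact Or.inr (mem_filter.2 ⟨heE, u, v, hu, hv, rfl, hp⟩)
  have hdisj : Disjoint E₁ E₂ := by
    rw [Finset.disjoint_left]
    intro e h1 h2
    obtain ⟨-, u, v, hu, hv, rfl, hp⟩ := mem_filter.1 h1
    obtain ⟨-, u', v', hu', hv', heq, hp'⟩ := mem_filter.1 h2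
    obtain ⟨rfl, rfl⟩ := horient u v u' v' hu hv hu' hv' heq
    exact hp' hp
  have h1ne : E₁.Nonempty :=
    ⟨s(ax, bx), mem_filter.2 ⟨(hE _).2 ⟨ax, bx, hax, hbxΛ, hbx, hadjx, rfl⟩, ax, bx, hax, hbx, rfl, by
      rw [hpx]; exact ReflTransGen.refl⟩⟩
  have h2ne : E₂.Nonempty :=
    ⟨s(ay, cy), mem_filter.2 ⟨(hE _).2 ⟨ay, cy, hay, hcyΛ, hcy, hadjy, rfl⟩, ay, cy, hay, hcy, rfl, by
      rw [hpy]; exact hxy⟩⟩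
  -- Lemma B.83 for the square lattice induced on `Λ`: one box square meets both classes
  obtain ⟨C, hC, ⟨e₁, he₁C, he₁⟩, ⟨e₂, he₂C, he₂⟩⟩ :=
    exists_generator_crossing_both_rel (G := zdGraph 2) (V := (↑Λ : Set (Site 2))) (𝒞 := boxSquares a b)
      (fun Z hZ heven => inSpan_boxSquares hZ heven)
      (fun C hC => isEvenEdgeSet_of_mem_boxSquares hC)
      (fun C hC => mem_edgeSet_of_mem_boxSquares hC)
      (fun u hu => mem_coe.2 (hAV hu)) hA hAc hEpart h1ne h2ne hdisj
  obtain ⟨he₁E, u₁, v₁, hu₁, hv₁, rfl, hp₁⟩ := mem_filter.1 he₁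
  obtain ⟨he₂E, u₂, v₂, hu₂, hv₂, rfl, hp₂⟩ := mem_filter.1 he₂
  have hadj₁ : (zdGraph 2).Adj u₁ v₁ ∧ v₁ ∈ Λ := by
    obtain ⟨u, v, hu, hvΛ, hv, hadj, heq⟩ := (hE _).1 he₁E
    obtain ⟨rfl, rfl⟩ := horient _ _ _ _ hu₁ hv₁ hu hv heq
    exact ⟨hadj, hvΛ⟩
  have hadj₂ : (zdGraph 2).Adj u₂ v₂ ∧ v₂ ∈ Λ := by
    obtain ⟨u, v, hu, hvΛ, hv, hadj, heq⟩ := (hE _).1 he₂E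
    obtain ⟨rfl, rfl⟩ := horient _ _ _ _ hu₂ hv₂ hu hv heq
    exact ⟨hadj, hvΛ⟩
  -- the two picked endpoints are distinct corners of the square `C`, hence `★`-adjacent
  have hw₁ : pick u₁ v₁ ∈ s(u₁, v₁) := by
    rcases hpick u₁ v₁ with h | h <;> rw [h]
    · exact Sym2.mem_mk_left _ _
    · exact Sym2.mem_mk_right _ _
  have hw₂ : pick u₂ v₂ ∈ s(u₂, v₂) := by
    rcases hpick u₂ v₂ with h | h <;> rw [h]
    · exact Sym2.mem_mk_left _ _
    · exact Sym2.mem_mk_right _ _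
  have hne : pick u₁ v₁ ≠ pick u₂ v₂ := fun h => hp₂ (h ▸ hp₁)
  obtain ⟨⟨g, rfl⟩, -⟩ := hC
  have hadj12 := zdStar_adj_of_mem_squareEdges he₁C he₂C hw₁ hw₂ hne
  have hP1 : pick u₁ v₁ ∈ P := ⟨u₁, v₁, hu₁, hadj₁.2, hv₁, hadj₁.1, rfl⟩
  have hP2 : pick u₂ v₂ ∈ P := ⟨u₂, v₂, hu₂, hadj₂.2, hv₂, hadj₂.1, rfl⟩
  exact hp₂ (ReflTransGen.tail hp₁ ⟨hadj12, hP1, hP2⟩)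

/-! ### §2 The components form: the rim of a pocket -/

/-- **The complement in a box of a nearest-neighbour component is nearest-neighbour connected.** Let `K ⊆ Λ = [a, b]`
be nn-connected (chains inside `K`) and let `A ⊆ Λ ∖ K` be closed under lattice steps inside `Λ ∖ K` (an
nn-component of `Λ ∖ K`). Then any two points of `Λ ∖ A` are joined by a chain inside `Λ ∖ A`: from a point of
`Λ ∖ A` a chain inside the box reaches `K` before it can enter `A`, and `K` is connected (the nn twin of the tree's
`starConn_sdiff_of_starComponent_box`). [cite: FriedliVelenik2017, §7.2.6, Exercise 7.11; DeuschelPisztora1996, Lemma 2.1 (ii)] -/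
theorem reflTransGen_adjIn_sdiff_of_component {a b : Site 2} {K A : Set (Site 2)}
    (hKV : K ⊆ (↑(Finset.Icc a b) : Set (Site 2)))
    (hK : ∀ x ∈ K, ∀ y ∈ K, ReflTransGen (adjIn (zdGraph 2) K) x y) (hAK : Disjoint A K)
    (hmax : ∀ x ∈ (↑(Finset.Icc a b) : Set (Site 2)), x ∉ K → ∀ z ∈ A, (zdGraph 2).Adj z x → x ∈ A) :
    ∀ u ∈ (↑(Finset.Icc a b) : Set (Site 2)) \ A, ∀ v ∈ (↑(Finset.Icc a b) : Set (Site 2)) \ A,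
      ReflTransGen (adjIn (zdGraph 2) ((↑(Finset.Icc a b) : Set (Site 2)) \ A)) u v := by
  classical
  set Λ : Finset (Site 2) := Finset.Icc a b with hΛ
  set W : Set (Site 2) := (↑Λ : Set (Site 2)) \ A with hW
  have hKW : K ⊆ W := fun z hz => ⟨hKV hz, fun hzA => Set.disjoint_left.1 hAK hzA hz⟩
  -- walking inside the box from a point of `W`: we stay in `W` until we reach the target or `K`
  have hit : ∀ (u w : Site 2), ReflTransGen (adjIn (zdGraph 2) (↑Λ : Set (Site 2))) u w → u ∈ W →
      ∃ z, ReflTransGen (adjIn (zdGraph 2) W) u z ∧ (z = w ∨ z ∈ K) := by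
    intro u w huw
    refine ReflTransGen.head_induction_on huw (fun _ => ⟨w, ReflTransGen.refl, Or.inl rfl⟩) ?_
    intro p c hpc _ ih hp
    by_cases hpK : p ∈ K
    · exact ⟨p, ReflTransGen.refl, Or.inr hpK⟩
    · have hcA : c ∉ A := fun hcA => hp.2 (hmax p hpc.2.1 hpK c hcA hpc.1.symm)
      have hc : c ∈ W := ⟨hpc.2.2, hcA⟩
      obtain ⟨z, hcz, hz⟩ := ih hc
      exact ⟨z, ReflTransGen.head ⟨hpc.1, hp, hc⟩ hcz, hz⟩
  intro u hu v hv
  obtain ⟨z, huz, hz⟩ := hit u v (reflTransGen_adjIn_Icc (mem_coe.1 hu.1) (mem_coe.1 hv.1)) hu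
  rcases hz with rfl | hzK
  · exact huz
  obtain ⟨z', hvz', hz'⟩ := hit v u (reflTransGen_adjIn_Icc (mem_coe.1 hv.1) (mem_coe.1 hu.1)) hv
  rcases hz' with rfl | hz'K
  · exact reflTransGen_adjIn_symm hvz'
  exact (huz.trans (reflTransGen_adjIn_mono hKW (hK z hzK z' hz'K))).trans (reflTransGen_adjIn_symm hvz')

/-- **The rim of a pocket is `★`-connected** (Deuschel–Pisztora's Lemma 2.1 (ii) situation, nearest-neighbour form,
inside a box). Let `O ⊆ Λ = [a, b] ⊆ ℤ²` be nn-connected and let `Q ⊆ Λ ∖ O` be nn-connected and closed under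
lattice steps inside `Λ ∖ O` (an nn-component of `Λ ∖ O`). Then the rim `{z ∈ Q : z ∼ u for some u ∈ O}` of `Q`
towards `O` is `★`-connected: Timár in the box for `A = Q` (whose complement `Λ ∖ Q ⊇ O` is nn-connected by
`reflTransGen_adjIn_sdiff_of_component`), picking the `Q`-endpoint; a box neighbour of `Q` outside `Q` lies in `O`.
[cite: Timar2013, Theorem 3; DeuschelPisztora1996, Lemma 2.1 (ii) (p. 471)] -/
theorem starConn_rim {a b : Site 2} {O Q : Finset (Site 2)} (hOV : O ⊆ Finset.Icc a b) (hQV : Q ⊆ Finset.Icc a b)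
    (hO : ∀ x ∈ O, ∀ y ∈ O, ReflTransGen (adjIn (zdGraph 2) (↑O : Set (Site 2))) x y)
    (hQ : ∀ x ∈ Q, ∀ y ∈ Q, ReflTransGen (adjIn (zdGraph 2) (↑Q : Set (Site 2))) x y)
    (hQO : Disjoint Q O)
    (hQmax : ∀ x ∈ Finset.Icc a b, x ∉ O → ∀ z ∈ Q, (zdGraph 2).Adj z x → x ∈ Q) :
    StarConn {z | z ∈ Q ∧ ∃ u ∈ O, (zdGraph 2).Adj u z} := by
  classical
  -- `Λ ∖ Q` is nn-connected
  have hcompl := reflTransGen_adjIn_sdiff_of_component (a := a) (b := b) (K := (↑O : Set (Site 2)))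
    (A := (↑Q : Set (Site 2))) (fun z hz => mem_coe.2 (hOV (mem_coe.1 hz)))
    (fun x hx y hy => hO x (mem_coe.1 hx) y (mem_coe.1 hy)) (Finset.disjoint_coe.2 hQO)
    (fun x hx hxO z hz hzx => mem_coe.2 (hQmax x (mem_coe.1 hx) (fun h => hxO (mem_coe.2 h)) z (mem_coe.1 hz) hzx))
  have hA : ∀ x ∈ Q, ∀ x' ∈ Q, ∃ p : (zdGraph 2).Walk x x', ∀ w ∈ p.support, w ∈ Q := by
    intro x hx x' hx'
    obtain ⟨p, hp⟩ := exists_walk_of_reflTransGen_adjIn (hQ x hx x' hx') (mem_coe.2 hx)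
    exact ⟨p, fun w hw => mem_coe.1 (hp w hw)⟩
  have hAc : ∀ y ∈ (↑(Finset.Icc a b) : Set (Site 2)), y ∉ Q → ∀ y' ∈ (↑(Finset.Icc a b) : Set (Site 2)), y' ∉ Q →
      ∃ p : (zdGraph 2).Walk y y', ∀ w ∈ p.support, w ∈ (↑(Finset.Icc a b) : Set (Site 2)) ∧ w ∉ Q := by
    intro y hy hyQ y' hy' hy'Q
    obtain ⟨p, hp⟩ := exists_walk_of_reflTransGen_adjIn (hcompl y ⟨hy, fun h => hyQ (mem_coe.1 h)⟩ y'
      ⟨hy', fun h => hy'Q (mem_coe.1 h)⟩) ⟨hy, fun h => hyQ (mem_coe.1 h)⟩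
    exact ⟨p, fun w hw => ⟨(hp w hw).1, fun h => (hp w hw).2 (mem_coe.2 h)⟩⟩
  have h := starConn_pick_box hQV hA hAc (fun u _ => u) (fun _ _ => Or.inl rfl)
  have hset : {z | z ∈ Q ∧ ∃ u ∈ O, (zdGraph 2).Adj u z} =
      {z | ∃ u v, u ∈ Q ∧ v ∈ Finset.Icc a b ∧ v ∉ Q ∧ (zdGraph 2).Adj u v ∧ u = z} := by
    ext z
    simp only [Set.mem_setOf_eq]
    constructor
    · rintro ⟨hz, u, hu, hadj⟩
      exact ⟨z, u, hz, hOV hu, fun h => Finset.disjoint_left.1 hQO h hu, hadj.symm, rfl⟩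
    · rintro ⟨u, v, hu, hvΛ, hv, hadj, rfl⟩
      refine ⟨hu, v, ?_, hadj.symm⟩
      by_contra hvO
      exact hv (hQmax v hvΛ hvO u hu hadj)
  rw [hset]; exact h

/-! ### §3 Sup-distance along `★`-chains -/

/-- Triangle inequality for the sup-distance. [folklore] -/
theorem supDist_triangle {d : ℕ} (x y z : Site d) : supDist x z ≤ supDist x y + supDist y z := by
  rw [supDist_le_iff]
  intro i
  have h1 := natAbs_sub_le_supDist x y i
  have h2 := natAbs_sub_le_supDist y z i
  omega

/-- The endpoints of a `★`-walk are at sup-distance at most its length. [folklore] -/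
theorem supDist_le_length {d : ℕ} {x y : Site d} (p : (zdStar d).Walk x y) : supDist x y ≤ p.length := by
  induction p with
  | nil => simp
  | cons h p ih =>
    rename_i u v w
    have h1 : supDist u v ≤ 1 := (zdStar_adj.1 h).2
    calc supDist u w ≤ supDist u v + supDist v w := supDist_triangle _ _ _
      _ ≤ 1 + p.length := add_le_add h1 ih
      _ = (Walk.cons h p).length := by rw [Walk.length_cons]; omega

/-- **A `★`-connected finite set lies within sup-distance `#Z - 1` of each of its points** (a shortest `★`-path
inside `Z` visits distinct points). [folklore] -/
theorem supDist_le_card_sub_one_of_starConn {d : ℕ} {Z : Finset (Site d)} (hZ : StarConn (↑Z : Set (Site d)))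
    {z₀ z : Site d} (hz₀ : z₀ ∈ Z) (hz : z ∈ Z) : supDist z₀ z ≤ #Z - 1 := by
  classical
  obtain ⟨p, hp⟩ := exists_walk_of_reflTransGen (hZ z₀ (mem_coe.2 hz₀) z (mem_coe.2 hz)) (mem_coe.2 hz₀)
  have hp' : ∀ w ∈ p.bypass.support, w ∈ Z := fun w hw => mem_coe.1 (hp w (p.support_bypass_subset_support hw))
  have hnodup : p.bypass.support.Nodup := p.bypass_isPath.support_nodup
  have hlen : p.bypass.support.length ≤ #Z := by
    rw [← List.toFinset_card_of_nodup hnodup]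
    exact Finset.card_le_card fun w hw => hp' w (List.mem_toFinset.1 hw)
  have h1 := supDist_le_length p.bypass
  have h2 : p.bypass.support.length = p.bypass.length + 1 := Walk.length_support _
  omega

end SlabBox

end Summit.CriticalPhenomena.PercolationContinuityZ3.Theorems.FK

end
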